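import Mathlib
import Summits.Ventures.HodgeRepro.Tier4.Line1.OrbitalTools
import Summits.Ventures.HodgeRepro.Tier4.Line1.ConvTest
import Summits.Ventures.HodgeRepro.Tier4.Line1.OrbitalPositive

/-!
# Tier4/Line1/OrbitalNonzero — LINE L1, J2.c′ `exists_pair_orbital_ne_zero`: THE ANALYTIC HALF OF THE HEART

Blind re-derivation cell `pub-hodge-repro`, Tier 4 «prove the step» (README §9–§10), seat t4-L1-p2 (prover, gen 0),
LINE L1 (t4-plan-1), assignment S12232 (J2.c′), rungs S12304.  This module: (c′.3) `exists_conv_orbital_close` — for a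
test function `f₁` supported in the open `U` and `ε > 0`, a normalised bump `f₂` at `1` (`ConvTest`) with `f₁ ⋆ f₂` a
test function supported in `U` and `‖O_o(f₁ ⋆ f₂) − O_o(f₁)‖ < ε` for every orbit `o` (the `‖·‖_∞` Lipschitz estimate
of `OrbitalTools` on functions supported in the fixed compact `tsupport f₁ · W₀`, `W₀` a compact neighbourhood of `1`);
and the GLUE: J2.c′ `exists_pair_orbital_ne_zero`, statement BYTE-IDENTICAL to Skeleton.lean v0.10 (FILED
3d8356354c198ec9, S12269) L531–L536 — `f₁` from (c′.2) with `r = Re O_{[γ₀]}(f₁) > 0`, `f₂` from (c′.3) with `ε = r`, and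
`|Re z| ≤ ‖z‖`.  HYPOTHESES AUDIT (the whole chain): `[Countable Gk]` only in (c′.2)'s positivity (`OrbitalPhase`'s
measure helper); `[LocallyCompactSpace G]` only for the existence of bumps (Urysohn) and a compact neighbourhood;
`[T2Space G]` in (c′.1) (compact ⇒ closed) and for `tsupport (f₁ ⋆ f₂)`; `hreg`, `CentralMatch`, `unit` only in (c′.1);
`rational` of `χ`, `χ'` only in (c′.2); the `Setting` field `rightInv` NOWHERE.
`#print axioms exists_pair_orbital_ne_zero` = [propext, Classical.choice, Quot.sound].

Nothing here says anything about the status of the Hodge conjecture for CM abelian varieties, which is NOT proved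
(HC_CM is NOT proved by anyone in this repository).
-/

set_option autoImplicit false

noncomputable section

/-! ## (c′.3) — the approximate identity keeps the orbital term within `ε` (t4-L1-p2, for J2.c′) -/

namespace Summit.Ventures.HodgeRepro.Tier4.Line1.RTF

open MeasureTheory Topology Filter Set
open scoped Pointwise

variable {G : Type} [Group G] [TopologicalSpace G] [IsTopologicalGroup G] [MeasurableSpace G]
  [BorelSpace G]

namespace Setting

variable (S : Setting G)

/-- (c′.3, L) APPROXIMATE IDENTITY: for a test function `f₁` supported in the open `U` and `ε > 0` there is a test
function `f₂` (a normalised non-negative bump at `1`) with `f₁ ⋆ f₂` a test function supported in `U` whose orbital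
term on any orbit `o` is within `ε` of that of `f₁` (`‖f₁ ⋆ f₂ − f₁‖_∞ ≤ η` by the uniform continuity of `f₁` and
left invariance of Haar measure; the orbital term is Lipschitz in `‖·‖_∞` for functions supported in a fixed
compact set, by (c′.0)). -/
theorem exists_conv_orbital_close [LocallyCompactSpace G] [T2Space G] {χ : S.T → ℂ} {χ' : S.T' → ℂ}
    (hχ : S.IsCharacter χ) (hχ' : S.IsCharacter' χ') (o : S.Orbit) {f₁ : G → ℂ} (h₁ : IsTest f₁)
    {U : Set G} (hU : IsOpen U) (hsub : tsupport f₁ ⊆ U) {ε : ℝ} (hε : 0 < ε) :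
    ∃ f₂ : G → ℂ, IsTest f₂ ∧ IsTest (S.conv f₁ f₂) ∧ tsupport (S.conv f₁ f₂) ⊆ U ∧
      ‖S.orbital χ χ' o (S.conv f₁ f₂) - S.orbital χ χ' o f₁‖ < ε := by
  classical
  -- a compact neighbourhood `W₀` of `1`; every support below lies in the compact `C = tsupport f₁ · W₀`
  obtain ⟨W₀, hW₀c, hW₀n⟩ := exists_compact_mem_nhds (1 : G)
  have h1W₀ : (1 : G) ∈ W₀ := mem_of_mem_nhds hW₀n
  have hCc : IsCompact (tsupport f₁ * W₀) := h₁.compact.mul hW₀c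
  set Γ : Finset S.Gk := (S.finite_hit_closure hCc).toFinset with hΓdef
  set L : ℝ := (Γ.card : ℝ) * S.μT.real S.DT * S.μT'.real S.DT' with hL
  have hL0 : 0 ≤ L := by positivity
  have hηpos : 0 < ε / (L + 1) := div_pos hε (by linarith)
  -- uniform continuity of `f₁` and the separation of `tsupport f₁` from `Uᶜ`
  obtain ⟨V, hVn, hV⟩ := h₁.exists_nhds_norm_sub_lt hηpos
  obtain ⟨W₁, hW₁n, hW₁⟩ := compact_open_separated_mul_right h₁.compact hU hsub
  -- the open neighbourhood `N` of `1` carrying the bump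
  have hNn : V⁻¹ ∩ W₁ ∩ W₀ ∈ 𝓝 (1 : G) :=
    Filter.inter_mem (Filter.inter_mem (inv_mem_nhds_one G hVn) hW₁n) hW₀n
  have h1N : (1 : G) ∈ interior (V⁻¹ ∩ W₁ ∩ W₀) := mem_interior_iff_mem_nhds.2 hNn
  obtain ⟨f₂, h₂, hf₂N, hnn, hnorm⟩ := S.exists_normalised_bump isOpen_interior h1N
  have hf₂sub : tsupport f₂ ⊆ V⁻¹ ∩ W₁ ∩ W₀ := hf₂N.trans interior_subset
  obtain ⟨hconv, hconvsub⟩ := S.conv_isTest h₁ h₂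
  refine ⟨f₂, h₂, hconv, ?_, ?_⟩
  · exact hconvsub.trans ((Set.mul_subset_mul_left (fun x hx => (hf₂sub hx).1.2)).trans hW₁)
  · have hΓ₁ : ∀ γ : S.Gk, γ ∉ Γ → ∀ t ∈ closure S.DT, ∀ t' ∈ closure S.DT',
        f₁ ((t : G)⁻¹ * γ * t') = 0 := fun γ hγ t ht t' ht' =>
      S.eq_zero_of_notMem_hit hCc (fun x hx => by simpa using Set.mul_mem_mul hx h1W₀) hγ ht ht'
    have hΓc : ∀ γ : S.Gk, γ ∉ Γ → ∀ t ∈ closure S.DT, ∀ t' ∈ closure S.DT',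
        S.conv f₁ f₂ ((t : G)⁻¹ * γ * t') = 0 := fun γ hγ t ht t' ht' =>
      S.eq_zero_of_notMem_hit hCc
        (hconvsub.trans (Set.mul_subset_mul_left (fun x hx => (hf₂sub hx).2))) hγ ht ht'
    have hbound : ∀ g, ‖S.conv f₁ f₂ g - f₁ g‖ ≤ ε / (L + 1) :=
      S.norm_conv_sub_le h₁ h₂ hnn hnorm (fun x hx => (hf₂sub hx).1.1)
        (fun g u hu => (hV g u hu).le)
    calc ‖S.orbital χ χ' o (S.conv f₁ f₂) - S.orbital χ χ' o f₁‖
        ≤ (Γ.card : ℝ) * (ε / (L + 1)) * S.μT.real S.DT * S.μT'.real S.DT' :=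
          S.norm_orbital_sub_le hχ hχ' o hconv h₁ hΓc hΓ₁ hbound
      _ = L * (ε / (L + 1)) := by rw [hL]; ring
      _ < ε := by
          rw [← mul_div_assoc, div_lt_iff₀ (by linarith)]
          nlinarith

/-- (J2.c′, glue from (c′.2) + (c′.3)): the statement of Skeleton-v0.10.lean L523–L529, byte-identical. -/
theorem exists_pair_orbital_ne_zero [Countable S.Gk] [LocallyCompactSpace G] [T2Space G] {χ : S.T → ℂ}
    {χ' : S.T' → ℂ} (hχ : S.IsCharacter χ) (hχ' : S.IsCharacter' χ') (hZ : S.CentralMatch χ χ') (γ₀ : S.Gk)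
    (hreg : ∀ t ∈ S.T, ∀ t' ∈ S.T', t⁻¹ * γ₀ * t' = γ₀ → t ∈ S.Z ∧ t' = t) {U : Set G} (hU : IsOpen U)
    (hγ : (γ₀ : G) ∈ U) :
    ∃ f₁ f₂ : G → ℂ, IsTest f₁ ∧ IsTest f₂ ∧ IsTest (S.conv f₁ f₂) ∧ tsupport (S.conv f₁ f₂) ⊆ U ∧
      S.orbital χ χ' (S.orbitOf γ₀) (S.conv f₁ f₂) ≠ 0 := by
  obtain ⟨f₁, h₁, hsub, hpos⟩ := S.exists_test_orbital_re_pos hχ hχ' hZ γ₀ hreg hU hγ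
  obtain ⟨f₂, h₂, hconv, hconvU, hclose⟩ :=
    S.exists_conv_orbital_close hχ hχ' (S.orbitOf γ₀) h₁ hU hsub hpos
  refine ⟨f₁, f₂, h₁, h₂, hconv, hconvU, ?_⟩
  intro h0
  rw [h0, zero_sub, norm_neg] at hclose
  exact absurd (Complex.abs_re_le_norm _) (not_le.2 (lt_of_lt_of_le hclose (le_abs_self _)))


end Setting

end Summit.Ventures.HodgeRepro.Tier4.Line1.RTF

end
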